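import Mathlib
import Summits.NavierStokesRegularity.NavierStokesRegularity.Theses.ExtremalEnstrophy
import HarnessLib

/-!
# `ExtremalEnstrophy.Assembly` — the route's assembly (item stmt-NavierStokesRegularity-18670; pure
  logic)

**Statement.** `MaximiserRigidity → CompactnessDichotomy → SplittingBound → SmallBudgetMonotone →
BudgetUpperSemicontinuity → BudgetLowerSemicontinuity → Enstrophy…`.

PROOF. The route file `Theses/ExtremalEnstrophy.lean` carries the planner-authored, kernel-checked
deciding theorem `Theses.ExtremalEnstrophy.closes`, whose hypotheses are exactly the route's items
and whose conclusion is the registered leaf; the assembly item is that implication written as ONE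
proposition, so it is closed by applying `closes` to the hypotheses (in the order `closes` expects).

HONEST FRAMING: glue between the route's own statements (about HYPOTHETICAL objects); nothing
here bears on the regularity problem itself.
-/

noncomputable section

set_option linter.dupNamespace false

namespace Summit.NavierStokesRegularity.NavierStokesRegularity.Theorems

open Summit.NavierStokesRegularity.NavierStokesRegularity.Theses.ExtremalEnstrophy in
/-- **Item stmt-NavierStokesRegularity-18670** (`ExtremalEnstrophy.Assembly`): the route's chain of
items implies its registered leaf, by the route file's deciding theorem `closes`. [this file] -/
theorem extremalEnstrophy_assembly_proof :
    Summit.NavierStokesRegularity.NavierStokesRegularity.Theses.ExtremalEnstrophy.Assembly := by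
  unfold Summit.NavierStokesRegularity.NavierStokesRegularity.Theses.ExtremalEnstrophy.Assembly
  intro hV2 hV1 hV3 hS1 hS2 hS3 hS4 hS5
  exact closes hV1 hV2 hV3 hS1 hS2 hS3 hS4 hS5

end Summit.NavierStokesRegularity.NavierStokesRegularity.Theorems

end
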